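import Summits.Ventures.HodgeRepro2.T5SU11JacobiIntegerWeight
import Summits.Ventures.HodgeRepro2.T5SU11JacobiSix

/-!
# Three-way cross-checks of the integer-weight Jacobi transforms: the Gamma–Pochhammer route
(`T5SU11JacobiIntegerWeight`) against the Legendre route (`T5SU11JacobiCrossCheck`, `T5SU11JacobiSix`)

The trigonometric-rational formulas of `T5SU11JacobiIntegerWeight` are evaluated at the even parameters
`λ = 4, 6`, where `cos(πλ/2) = ±1`, and compared with the values obtained independently from the explicit
spherical functions `φ_4 = cosh 2t`, `φ_6 = P_2(cosh 2t)` and the Cartan integration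
(`integral_orbit_rpow_mul_sph_four`: `2πk/((k−2)(k−4))`; `integral_orbit_rpow_mul_sph_six`:
`2πk(k+2)/((k−2)(k−4)(k−6))`): **weight 5 at `λ = 4`: `10π/3` both ways**
(`integral_orbit_rpow_five_mul_sph_four`, `…'`); **weight 7** — first made explicit,
`m̂_7(λ) = 2π(1−λ)(3−λ)(5−λ)(1+λ)(3+λ)/(225 cos(πλ/2))` (`integral_orbit_rpow_seven_mul_sph`) — **at
`λ = 4`: `14π/15` both ways** (`integral_orbit_rpow_seven_mul_sph_four`, `…'`) and **at `λ = 6`: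
`42π/5` both ways** (`integral_orbit_rpow_seven_mul_sph_six`, `…'`); the critical value
`m̂_7(1) = C_7² = 256/225` (`integral_orbit_rpow_seven_mul_sph_one`) and the `L¹`-norm `2π/5`
(`integral_orbit_rpow_seven`) close the table for the weight `7`. Nothing is claimed about (N).

Blind lane: Mathlib + the HodgeRepro2 prefix only; no sorry; axioms ⊆ {propext, Classical.choice,
Quot.sound}.
-/

namespace Summit.Ventures.HodgeRepro2.T5SU11JacobiIntegerCrossCheck

open MeasureTheory MeasureTheory.Measure Metric Set Filter Topology
open T5SU11Unimodular T5SU11Fibration T5SU11Cartan T5HaarCircle T5BergmanCoefficient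
  T5SU11FibrationHaar T5SU11SphericalFunction T5SU11SphericalSymmetry T5SU11JacobiIwasawa
  T5SU11JacobiTransform T5SU11JacobiCrossCheck T5SU11JacobiSix T5SU11XiTransform
  T5SU11JacobiThreeFour T5SU11AbelConstInteger T5SU11JacobiIntegerWeight
open scoped Real Nat

/-- `cos(π · 4/2) = 1`. -/
lemma cos_pi_mul_four_div_two : Real.cos (π * 4 / 2) = 1 := by
  rw [show π * 4 / 2 = 2 * π by ring, Real.cos_two_pi]

/-- `cos(π · 6/2) = −1`. -/
lemma cos_pi_mul_six_div_two : Real.cos (π * 6 / 2) = -1 := by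
  rw [show π * 6 / 2 = π + 2 * π by ring, Real.cos_add_two_pi, Real.cos_pi]

section measure

variable [MeasurableSpace Circle] [BorelSpace Circle]

/-! ### Weight `5` at `λ = 4` -/

/-- **Weight 5 at `λ = 4`, Gamma–Pochhammer route**: `∫_G (1 − |g·0|²)^{5/2} φ_4 dν = 10π/3`. -/
theorem integral_orbit_rpow_five_mul_sph_four :
    ∫ g, (1 - ‖orbit g‖ ^ 2) ^ ((5 : ℝ) / 2) * sph 4 g ∂(nu haarCircle) = 10 * π / 3 := by
  rw [integral_orbit_rpow_five_mul_sph (by norm_num) (by norm_num)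
    (by rw [cos_pi_mul_four_div_two]; exact one_ne_zero), cos_pi_mul_four_div_two]
  ring

/-- **Weight 5 at `λ = 4`, Legendre route** (`φ_4 = cosh 2t`, Cartan integration): the same `10π/3`. -/
theorem integral_orbit_rpow_five_mul_sph_four' :
    ∫ g, (1 - ‖orbit g‖ ^ 2) ^ ((5 : ℝ) / 2) * sph 4 g ∂(nu haarCircle) = 10 * π / 3 := by
  rw [integral_orbit_rpow_mul_sph_four (k := 5) (by norm_num)]
  ring

/-! ### Weight `7` -/

/-- **Weight 7**: `∫_G (1 − |g·0|²)^{7/2} φ_λ dν = 2π(1−λ)(3−λ)(5−λ)(1+λ)(3+λ)/(225 cos(πλ/2))` for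
`−5 < λ < 7` away from the zeros of the cosine. -/
theorem integral_orbit_rpow_seven_mul_sph {lam : ℝ} (h1 : -5 < lam) (h2 : lam < 7)
    (hc : Real.cos (π * lam / 2) ≠ 0) :
    ∫ g, (1 - ‖orbit g‖ ^ 2) ^ ((7 : ℝ) / 2) * sph lam g ∂(nu haarCircle)
      = 2 * π * (1 - lam) * (3 - lam) * (5 - lam) * (1 + lam) * (3 + lam)
          / (225 * Real.cos (π * lam / 2)) := by
  rw [show (7 : ℝ) / 2 = ((2 * 3 + 1 : ℕ) : ℝ) / 2 by norm_num,
    integral_orbit_rpow_odd_mul_sph 3 (by norm_num) (by push_cast; linarith) (by push_cast; linarith) hc]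
  simp only [Finset.prod_range_succ, Finset.prod_range_zero, Nat.cast_zero, Nat.cast_one, add_zero,
    Nat.cast_ofNat]
  norm_num [Nat.factorial]
  field_simp
  ring

/-- **Weight 7 at `λ = 4`, Gamma–Pochhammer route**: `14π/15`. -/
theorem integral_orbit_rpow_seven_mul_sph_four :
    ∫ g, (1 - ‖orbit g‖ ^ 2) ^ ((7 : ℝ) / 2) * sph 4 g ∂(nu haarCircle) = 14 * π / 15 := by
  rw [integral_orbit_rpow_seven_mul_sph (by norm_num) (by norm_num)
    (by rw [cos_pi_mul_four_div_two]; exact one_ne_zero), cos_pi_mul_four_div_two]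
  ring

/-- **Weight 7 at `λ = 4`, Legendre route**: the same `14π/15`. -/
theorem integral_orbit_rpow_seven_mul_sph_four' :
    ∫ g, (1 - ‖orbit g‖ ^ 2) ^ ((7 : ℝ) / 2) * sph 4 g ∂(nu haarCircle) = 14 * π / 15 := by
  rw [integral_orbit_rpow_mul_sph_four (k := 7) (by norm_num)]
  ring

/-- **Weight 7 at `λ = 6`, Gamma–Pochhammer route** (`cos 3π = −1`): `42π/5`. -/
theorem integral_orbit_rpow_seven_mul_sph_six :
    ∫ g, (1 - ‖orbit g‖ ^ 2) ^ ((7 : ℝ) / 2) * sph 6 g ∂(nu haarCircle) = 42 * π / 5 := by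
  rw [integral_orbit_rpow_seven_mul_sph (by norm_num) (by norm_num)
    (by rw [cos_pi_mul_six_div_two]; norm_num), cos_pi_mul_six_div_two]
  ring

/-- **Weight 7 at `λ = 6`, Legendre route** (`φ_6 = P_2(cosh 2t)`): the same `42π/5`. -/
theorem integral_orbit_rpow_seven_mul_sph_six' :
    ∫ g, (1 - ‖orbit g‖ ^ 2) ^ ((7 : ℝ) / 2) * sph 6 g ∂(nu haarCircle) = 42 * π / 5 := by
  rw [integral_orbit_rpow_mul_sph_six (k := 7) (by norm_num)]
  ring

/-- **Weight 7 at the critical parameter**: `∫_G (1 − |g·0|²)^{7/2} Ξ dν = C_7² = 256/225`. -/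
theorem integral_orbit_rpow_seven_mul_sph_one :
    ∫ g, (1 - ‖orbit g‖ ^ 2) ^ ((7 : ℝ) / 2) * sph 1 g ∂(nu haarCircle) = 256 / 225 := by
  rw [show ((7 : ℝ) / 2) = ((2 * 3 + 1 : ℕ) : ℝ) / 2 by norm_num,
    integral_orbit_rpow_odd_mul_sph_one 3 (by norm_num)]
  norm_num [Nat.factorial]

/-- **Weight 7, `L¹`-norm**: `∫_G (1 − |g·0|²)^{7/2} dν = 2π/5` (from the weight-7 formula at `λ = 0`,
agreeing with `integral_orbit_rpow_nu`). -/
theorem integral_orbit_rpow_seven :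
    ∫ g, (1 - ‖orbit g‖ ^ 2) ^ ((7 : ℝ) / 2) ∂(nu haarCircle) = 2 * π / 5 := by
  have h := integral_orbit_rpow_seven_mul_sph (lam := 0) (by norm_num) (by norm_num)
    (by rw [mul_zero, zero_div, Real.cos_zero]; exact one_ne_zero)
  simp only [sph_zero, mul_one, mul_zero, zero_div, Real.cos_zero, sub_zero, add_zero] at h
  rw [h]
  ring

/-- The same `2π/5` by `integral_orbit_rpow_nu` (`2π/(7 − 2)`). -/
theorem integral_orbit_rpow_seven' :
    ∫ g, (1 - ‖orbit g‖ ^ 2) ^ ((7 : ℝ) / 2) ∂(nu haarCircle) = 2 * π / 5 := by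
  rw [integral_orbit_rpow_nu (by norm_num)]
  norm_num

end measure

end Summit.Ventures.HodgeRepro2.T5SU11JacobiIntegerCrossCheck
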